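import Mathlib
import HarnessLib
import Summits.AtomisticToContinuum.Crystallization.Theorems.PricedLinkCensusSoftFourRingsRigPairs

/-!
# Two-shell rigidity, slot 3 · the `SphericalLsFit` replay engine (1): brace rows, cuts, the `fit`
# instruction, the checker and the data format   (decomp-a2c, lens 3, gen 37 — NODE «SphericalLsFitReplay»)

The `Rig` engine (`…RigRows` … `…RigFinal`, pair-target variant `…RigPairs`) replays, cell by cell over
the free parameter, LP dual certificates in exact integer arithmetic at scale `S = 2^60` and certifies
that every labelled twelve-point configuration in the one-percent windows is `6/25`-close to a rotated
pattern.  The consumer of slot 3 of the `31280` assembly is the registered statement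
`FrustratedLawDichotomyTwoShellRigidityLsLedger.SphericalLsFit β θ Pat D α Ω V₁ V₃` (file `…LsLedgerArrow`,
β = 7/200 from `CapBrace`, θ = 1/100, `D = probes26`): for every admissible direction field `e` on the
pattern there is a frame `A` whose residual field `r u = A⁻¹ (e u) − u` has (F0) `‖r u‖ ≤ α`, (F1) least-squares
rotation `‖ω‖ ≤ Ω` (`ω = (1/8) Σ u × r u`), (F2) `⟪n, r u − ω × u⟫ ≤ V₁` and (F3)
`⟪n, (r u − ω × u) − (r w − ω × w)⟫ ≤ V₃` on bonds, for all probes `n ∈ D`.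

This file is the COMPUTABLE ENGINE DELTA that certifies exactly these four families per leaf:

* `Model.brace` / `braceRows`: the `√2`-pairs of the pattern (`|tab i − tab j|² = 2N`) contribute, once both
  points are placed, the two-sided window `|S²·⟪x i, x j⟫| ≤ B2` (`B2 ≥ β S²`), linearised exactly like
  `pairRows` (upper row = the non-bond row with `CNB2 ↦ B2`, lower row = `targetRow bx ⟨i, j, −B2⟩`);
* `Cut` / `InstrF.split`: a binary split of a cell along an arbitrary integer linear form of the
  coordinates (`Σ a·x ≤ ub/S` on the first sub-stream, `≥` on the second; used for the ω-sub-leaves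
  `|ω_k − c_k| ≤ 0.02` of the census B-run), the accumulated cuts being extra LP rows (`cutRow`);
* `InstrF.fit qw qx qy qz refl certs`: the terminal instruction of an alive leaf.  The frame is
  `A = (frame of the configuration) ∘ R`, `R = quatMat/n` the rational rotation of the integer quaternion
  (as in `Rig.applyObjective`); (F0)–(F3) become INTEGER linear functionals of the coordinates
  (`fitObj0`, `fitObjW`, `fitObj2`, `fitObj3` — the probe `m/√k` is multiplied through by `√k`, the pattern
  point `tab/√N` by `8nN`, the one irrational constant `⟪m, tab i⟫/√N` is enclosed by `invSqrtLo/Hi`),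
  each bounded over the leaf by a `certUpper` certificate from `certs` (canonical order `fitCertIndex…`:
  12 F0, 6 F1, `12·J` F2, `P·J` F3 for `J` probes and `P` bonded pairs `i < j`; a missing certificate is the
  empty one = pure interval bound), and compared with the integer levels of `FitPrm`
  (`F0L ≥ S√N(1−α²/2)`, `OM2 ≤ 64 N Ω² S²`, `V1K k ≤ 8 N S √k V₁`, `V3K k ≤ 8 N S √k V₃`);
* `rowsOfF = rowsOf ++ braceRows ++ cutRows` (canonical indices unchanged), `runInstrsF` (same nesting
  discipline as `runInstrs`; success = every branch pruned or fit-verified), `runCellF`, `checkAllF`;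
  the decoder `decodeCellF` (same byte format as `decodeCell`; opcodes 0 bound, 1 prune, 2 place,
  4 split, 5 fit) is part (1b) `…LsFitReplayDecode`.

Soundness (box level, replay induction, the real meaning of a verified fit, and the wrapper to
`SphericalLsFit (7/200) (1/100) fcc/hcpKissingPattern probes26 α Ω V₁ V₃`) is in the sequels
`…LsFitReplaySound*`.  `[folklore]`; no `sorry`; no `instance`/`notation`; no data.
-/

namespace Summit.AtomisticToContinuum.Crystallization.Theorems

namespace Rig

open Literature.Analysis.ValidatedNumerics.NumericsMP
open scoped Matrix

/-! ### Integer vector helpers -/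

/-- Integer cross product (standard orientation, as `…LsLedgerFrame.cross`). -/
def crossZ (a b : Fin 3 → ℤ) : Fin 3 → ℤ :=
  ![a 1 * b 2 - a 2 * b 1, a 2 * b 0 - a 0 * b 2, a 0 * b 1 - a 1 * b 0]

/-- Integer dot product. -/
def dotZ (a b : Fin 3 → ℤ) : ℤ := ∑ k, a k * b k

/-- `(M t)_k = Σ_l M k l · t l`. -/
def mulVecZ (M : Fin 3 → Fin 3 → ℤ) (t : Fin 3 → ℤ) : Fin 3 → ℤ := fun k => ∑ l, M k l * t l

/-! ### Parameters of a fit run -/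

/-- Integer levels indexed by the probe type `k ∈ {1, 2, 3}` (probe `m/√k`). -/
structure KLevels where
  /-- level for axis probes (`k = 1`) -/
  k1 : ℤ
  /-- level for face-diagonal probes (`k = 2`) -/
  k2 : ℤ
  /-- level for body-diagonal probes (`k = 3`) -/
  k3 : ℤ

/-- The level of probe type `k` (junk `k3` outside `{1, 2, 3}`; such types are rejected by `kOK`). -/
def KLevels.getK (L : KLevels) (k : ℕ) : ℤ := if k = 1 then L.k1 else if k = 2 then L.k2 else L.k3

/-- Supported probe types `k ∈ {1, 2, 3}` (probe `m/√k`). -/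
def kOK (k : ℕ) : Bool := decide (k = 1 ∨ k = 2 ∨ k = 3)

/-- **Parameters of a `SphericalLsFit` replay.**  The real targets `(β, α, Ω, V₁, V₃)` enter only through
these integers; the wrapper theorem asks `β·S² ≤ B2`, `S·√N·(1 − α²/2) ≤ F0L`, `OM2 ≤ 64·N·Ω²·S²`,
`V1K k ≤ 8·N·S·√k·V₁`, `V3K k ≤ 8·N·S·√k·V₃` (`N = m.normSq`). -/
structure FitPrm where
  /-- brace level: `|S²·⟪x i, x j⟫| ≤ B2` on `√2`-pairs -/
  B2 : ℤ
  /-- F0 level (scale `S`, multiplied by the quaternion norm `n` at use) -/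
  F0L : ℤ
  /-- F1 level (scale `S²`, multiplied by `n²` at use) -/
  OM2 : ℤ
  /-- F2 levels by probe type (scale `S`, multiplied by `n` at use) -/
  V1K : KLevels
  /-- F3 levels by probe type -/
  V3K : KLevels
  /-- the probe table: `(m, k)` stands for the unit probe `m/√k` of `D` -/
  ptab : List ((Fin 3 → ℤ) × ℕ)

/-- **The integer table of `probes26`** (`…GaugedLadderD.probes26 = axisProbes ++ diagProbes`, same order):
`±e_k` (`k = 1`), the twelve `(±1,±1,0)`-type vectors (`k = 2`), the eight `(±1,±1,±1)` (`k = 3`). -/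
def ptab26 : List ((Fin 3 → ℤ) × ℕ) :=
  [(![1, 0, 0], 1), (![0, 1, 0], 1), (![0, 0, 1], 1), (![-1, 0, 0], 1), (![0, -1, 0], 1), (![0, 0, -1], 1),
   (![1, 1, 0], 2), (![1, -1, 0], 2), (![-1, 1, 0], 2), (![-1, -1, 0], 2),
   (![1, 0, 1], 2), (![1, 0, -1], 2), (![-1, 0, 1], 2), (![-1, 0, -1], 2),
   (![0, 1, 1], 2), (![0, 1, -1], 2), (![0, -1, 1], 2), (![0, -1, -1], 2),
   (![1, 1, 1], 3), (![1, 1, -1], 3), (![1, -1, 1], 3), (![1, -1, -1], 3),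
   (![-1, 1, 1], 3), (![-1, 1, -1], 3), (![-1, -1, 1], 3), (![-1, -1, -1], 3)]

/-! ### Brace pairs and brace rows -/

/-- The `√2`-pairs of the pattern: `|tab i − tab j|² = 2·N`, i.e. `dist (tab i/√N) (tab j/√N) = √2`
(the 12 diagonals of the six square faces of the cuboctahedron / anticuboctahedron). -/
def Model.brace (m : Model) (i j : Fin 12) : Bool :=
  decide ((∑ k, (m.tab i k - m.tab j k) ^ 2) = 2 * (m.normSq : ℤ))

/-- The brace pairs `i < j`, in the order of `allPairs`. -/
def bracePairs (m : Model) : List (Fin 12 × Fin 12) := allPairs.filter fun p => m.brace p.1 p.2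

/-- The bonded pairs `i < j`, in the order of `allPairs` (24 for both models): the F3 index set. -/
def bondPairs (m : Model) : List (Fin 12 × Fin 12) := allPairs.filter fun p => m.bond p.1 p.2

/-- The two brace rows of a placed `√2`-pair: `S²·⟪x i, x j⟫ ≤ B2` (the non-bond row of `pairRows`
with `CNB2 ↦ B2`) and `−B2 ≤ S²·⟪x i, x j⟫` (`= targetRow bx ⟨i, j, −B2⟩`). -/
def bracePairRows (B2 : ℤ) (bx : Boxes) (i j : Fin 12) : List Row :=
  [⟨pairCoeff bx i j, B2 - c0 bx i j + rem bx i j⟩, targetRow bx ⟨i, j, -B2⟩]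

/-- The brace rows of the current boxes (a pair contributes once both points are placed). -/
def braceRows (m : Model) (B2 : ℤ) (bx : Boxes) : List Row :=
  (bracePairs m).flatMap fun p => if bx.placed p.1 && bx.placed p.2 then bracePairRows B2 bx p.1 p.2 else []

/-! ### Cuts -/

/-- An ABSOLUTE linear cut `Σ_{v,k} a v k · x v k ≤ ub/S` (integer coefficients, bound at scale `S`);
only created when all twelve points are placed. -/
structure Cut where
  /-- coefficients -/
  a : Fin 12 → Fin 3 → ℤ
  /-- scaled bound -/
  ub : ℤ

/-- The opposite closed half-space `Σ a·x ≥ ub/S`. -/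
def Cut.neg (c : Cut) : Cut := ⟨fun v k => -c.a v k, -c.ub⟩

/-- `Σ a·C` (scale `S`): the value of an integer coefficient field at the box centres. -/
def centreVal (bx : Boxes) (g : Fin 12 → Fin 3 → ℤ) : ℤ := ∑ v, ∑ k, g v k * bx.C v k

/-- The LP row of a cut relative to the current centres: `Σ a·d ≤ (ub − Σ a·C)/S`. -/
def cutRow (bx : Boxes) (c : Cut) : Row := ⟨c.a, c.ub - centreVal bx c.a⟩

/-- Dense coefficient field of a sparse list `(v, k, coefficient)` (repeated entries add up). -/
def denseCoeff : List (ℕ × ℕ × ℤ) → Fin 12 → Fin 3 → ℤ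
  | [], _, _ => 0
  | t :: ts, v, k => (if toFin12 t.1 = v ∧ toFin3 t.2.1 = k then t.2.2 else 0) + denseCoeff ts v k

/-- **The extended canonical row list**: canonical rows (indices unchanged), then brace rows, then the
rows of the accumulated cuts (most recent cut first). -/
def rowsOfF (m : Model) (prm : FitPrm) (bx : Boxes) (cuts : List Cut) : List Row :=
  rowsOf m.bond bx ++ braceRows m prm.B2 bx ++ cuts.map (cutRow bx)

/-! ### Instructions and cells -/

/-- Checker instructions of a fit run (with their untrusted certificates). -/
inductive InstrF : Type
  /-- shrink coordinate `k` of point `v` from above (`up`) or below, by a bound certificate -/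
  | bound (v : Fin 12) (k : Fin 3) (up : Bool) (cert : Cert) : InstrF
  /-- the cell is infeasible (Farkas certificate) -/
  | prune (terms : List (ℕ × ℕ)) : InstrF
  /-- place the next construction step (as `Instr.place`) -/
  | place (terms : List (ℕ × ℕ)) (altLen : ℕ) : InstrF
  /-- binary split along the cut `Σ a·x ≤ ub/S` (sparse `a`): the next `len` instructions are run with the
  cut added, the remaining ones with the opposite cut added; both must succeed -/
  | split (a : List (ℕ × ℕ × ℤ)) (ub : ℤ) (len : ℕ) : InstrF
  /-- terminal fit test in the frame of the integer quaternion (third column reflected if `refl`),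
  with the bound certificates of the fit functionals in canonical order -/
  | fit (qw qx qy qz : ℤ) (refl : Bool) (certs : List Cert) : InstrF

/-- A cell of a fit run: chart, scaled `y`-interval of the free point, instruction stream. -/
structure CellF where
  /-- chart -/
  xpos : Bool
  /-- scaled lower end of the `y`-interval -/
  tlo : ℤ
  /-- scaled upper end of the `y`-interval -/
  thi : ℤ
  /-- instructions -/
  instrs : List InstrF

/-- The underlying parameter cell (for `initBoxes`, `coversChart`, `InCell`). -/
def CellF.skel (c : CellF) : Cell := ⟨c.xpos, c.tlo, c.thi, []⟩

/-! ### Certified values of integer linear functionals -/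

/-- **Certified upper value** `S·(Σ g·x) ≤ valUpper` on the current boxes and rows. -/
def valUpper (bx : Boxes) (rows : Array Row) (g : Fin 12 → Fin 3 → ℤ) (cert : Cert) : ℤ :=
  centreVal bx g + certUpper bx rows g cert

/-- **Certified lower value** `valLower ≤ S·(Σ g·x)` (certificate for the objective `−g`). -/
def valLower (bx : Boxes) (rows : Array Row) (g : Fin 12 → Fin 3 → ℤ) (cert : Cert) : ℤ :=
  centreVal bx g - certUpper bx rows (fun v k => -g v k) cert

/-! ### The fit functionals of a leaf frame `R = M/n` -/

/-- (F0) at point `i`: `x ↦ Σ_k (M tab i)_k · x i k` (`= n·√N·⟪x i, R uᵢ⟫`, `uᵢ = tab i/√N`). -/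
def fitObj0 (m : Model) (Mq : Fin 3 → Fin 3 → ℤ) (i : Fin 12) : Fin 12 → Fin 3 → ℤ :=
  fun v k => if v = i then mulVecZ Mq (m.tab i) k else 0

/-- (F1) coefficient field of `W_k`, `W(x) = Σ_i tab i × (Mᵀ x i)` (`ω = W/(8 n √N)` is the least-squares
rotation `lsRot` of the residual field `Rᵀ x i − uᵢ`). -/
def fitObjW (m : Model) (Mq : Fin 3 → Fin 3 → ℤ) (k : Fin 3) : Fin 12 → Fin 3 → ℤ :=
  fun i b => crossZ (m.tab i) (fun a => Mq b a) k

/-- (F2) for the integer probe `mv` at point `i`: `G(x) = 8N·Σ_a (M mv)_a x i a − Σ_k (tab i × mv)_k W_k(x)`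
(`√k·⟪mv/√k, rᵢ − ω × uᵢ⟫ = G(x)/(8 n N) − ⟪mv, tab i⟫/√N`). -/
def fitObj2 (m : Model) (Mq : Fin 3 → Fin 3 → ℤ) (mv : Fin 3 → ℤ) (i : Fin 12) : Fin 12 → Fin 3 → ℤ :=
  fun v b => (if v = i then 8 * (m.normSq : ℤ) * mulVecZ Mq mv b else 0)
    - ∑ k, crossZ (m.tab i) mv k * fitObjW m Mq k v b

/-- (F3) for the probe `mv` on the ordered bond `(i, w)`: `fitObj2 i − fitObj2 w`. -/
def fitObj3 (m : Model) (Mq : Fin 3 → Fin 3 → ℤ) (mv : Fin 3 → ℤ) (i w : Fin 12) : Fin 12 → Fin 3 → ℤ :=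
  fun v b => fitObj2 m Mq mv i v b - fitObj2 m Mq mv w v b

/-- Directed enclosure of the irrational constant `S·c/√N` from below: `encBelow N c ≤ S·c/√N`
(`invSqrtLo N ≤ S/√N ≤ invSqrtHi N`). -/
def encBelow (N : ℕ) (c : ℤ) : ℤ := if 0 ≤ c then c * invSqrtLo N else c * invSqrtHi N

/-! ### The canonical certificate order of a fit -/

/-- Index of the F0 certificate of point `i` (objective `−fitObj0 i`). -/
def fitIdx0 (i : Fin 12) : ℕ := i.val
/-- Index of the F1 certificate of `W_k` (`up`: objective `fitObjW k`; else `−fitObjW k`). -/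
def fitIdx1 (k : Fin 3) (up : Bool) : ℕ := 12 + 2 * k.val + (if up then 0 else 1)
/-- Index of the F2 certificate of probe number `j` at point `i` (objective `fitObj2`). -/
def fitIdx2 (j : ℕ) (i : Fin 12) : ℕ := 18 + 12 * j + i.val
/-- Index of the F3 certificate of probe number `j` on bond-pair number `t` (objective `fitObj3 i w`,
`(i, w)` the `t`-th entry of `bondPairs`), for `J` probes. -/
def fitIdx3 (J P : ℕ) (j t : ℕ) : ℕ := 18 + 12 * J + P * j + t
/-- Total number of certificates of a fit: `18 + 12·J + P·J`. -/
def fitCertCount (m : Model) (prm : FitPrm) : ℕ :=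
  18 + 12 * prm.ptab.length + (bondPairs m).length * prm.ptab.length

/-- The `i`-th certificate (the empty certificate = pure interval bound if absent). -/
def certAt (certs : List Cert) (i : ℕ) : Cert := certs.getD i (1, [])

/-! ### The fit tests -/

/-- (F0) test: `n·F0L ≤ S·Σ_k (M tab i)_k x i k` certified for every `i`. -/
def fitTest0 (m : Model) (prm : FitPrm) (bx : Boxes) (rows : Array Row) (Mq : Fin 3 → Fin 3 → ℤ) (n : ℤ)
    (certs : List Cert) : Bool :=
  (List.finRange 12).all fun i =>
    decide (n * prm.F0L ≤ valLower bx rows (fitObj0 m Mq i) (certAt certs (fitIdx0 i)))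

/-- Certified bound `|S·W_k(x)| ≤ fitAbsW k`. -/
def fitAbsW (m : Model) (bx : Boxes) (rows : Array Row) (Mq : Fin 3 → Fin 3 → ℤ) (certs : List Cert)
    (k : Fin 3) : ℤ :=
  max (valUpper bx rows (fitObjW m Mq k) (certAt certs (fitIdx1 k true)))
    (-(valLower bx rows (fitObjW m Mq k) (certAt certs (fitIdx1 k false))))

/-- (F1) test: `Σ_k (fitAbsW k)² ≤ n²·OM2`. -/
def fitTest1 (m : Model) (prm : FitPrm) (bx : Boxes) (rows : Array Row) (Mq : Fin 3 → Fin 3 → ℤ) (n : ℤ)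
    (certs : List Cert) : Bool :=
  decide ((∑ k, fitAbsW m bx rows Mq certs k ^ 2) ≤ n ^ 2 * prm.OM2)

/-- (F2) test, for the `j`-th probe `(mv, k)` and every point `i`:
`valUpper (fitObj2 mv i) − 8 n N · encBelow ⟪mv, tab i⟫ ≤ n · V1K k`. -/
def fitTest2 (m : Model) (prm : FitPrm) (bx : Boxes) (rows : Array Row) (Mq : Fin 3 → Fin 3 → ℤ) (n : ℤ)
    (certs : List Cert) : Bool :=
  (List.range prm.ptab.length).all fun j =>
    let e := prm.ptab.getD j (0, 0)
    kOK e.2 &&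
      (List.finRange 12).all fun i =>
        decide (valUpper bx rows (fitObj2 m Mq e.1 i) (certAt certs (fitIdx2 j i))
          - 8 * n * (m.normSq : ℤ) * encBelow m.normSq (dotZ e.1 (m.tab i)) ≤ n * prm.V1K.getK e.2)

/-- (F3) test, for the `j`-th probe `(mv, k)` and the `t`-th bonded pair `(i, w)` (`i < w`):
`valUpper (fitObj3 mv i w) − 8 n N · encBelow ⟪mv, tab i − tab w⟫ ≤ n · V3K k`. -/
def fitTest3 (m : Model) (prm : FitPrm) (bx : Boxes) (rows : Array Row) (Mq : Fin 3 → Fin 3 → ℤ) (n : ℤ)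
    (certs : List Cert) : Bool :=
  (List.range prm.ptab.length).all fun j =>
    let e := prm.ptab.getD j (0, 0)
    kOK e.2 &&
      (List.range (bondPairs m).length).all fun t =>
        let q := (bondPairs m).getD t (0, 0)
        decide (valUpper bx rows (fitObj3 m Mq e.1 q.1 q.2)
            (certAt certs (fitIdx3 prm.ptab.length (bondPairs m).length j t))
          - 8 * n * (m.normSq : ℤ) * encBelow m.normSq (dotZ e.1 (fun k => m.tab q.1 k - m.tab q.2 k))
            ≤ n * prm.V3K.getK e.2)

/-- **Apply the fit instruction**: all construction steps consumed, all points placed, quaternion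
non-zero, and the four tests (F0)–(F3) against the extended rows. -/
def applyFit (m : Model) (prm : FitPrm) (bx : Boxes) (st : List Step) (cuts : List Cut)
    (qw qx qy qz : ℤ) (refl : Bool) (certs : List Cert) : Bool :=
  if st.isEmpty && (List.finRange 12).all (fun v => bx.placed v) && decide (0 < quatNorm qw qx qy qz)
  then
    let rows := (rowsOfF m prm bx cuts).toArray
    let Mq := quatMat qw qx qy qz refl
    let n := quatNorm qw qx qy qz
    fitTest0 m prm bx rows Mq n certs && fitTest1 m prm bx rows Mq n certs &&
      fitTest2 m prm bx rows Mq n certs && fitTest3 m prm bx rows Mq n certs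
  else false

/-! ### The checker -/

/-- Apply a bound instruction against the extended rows. -/
def applyBoundF (m : Model) (prm : FitPrm) (bx : Boxes) (st : List Step) (cuts : List Cut) (v : Fin 12)
    (k : Fin 3) (up : Bool) (cert : Cert) : Outcome :=
  match bx v with
  | none => Outcome.failed
  | some B =>
    let rows := (rowsOfF m prm bx cuts).toArray
    let U := certUpper bx rows (unitObj v k up) cert
    let I := B.get k
    let C := bx.C v k
    let I' : MI := if up then ⟨I.lo, min I.hi (C + U)⟩ else ⟨max I.lo (C - U), I.hi⟩
    if I'.hi < I'.lo then Outcome.pruned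
    else Outcome.running (Function.update bx v (some (B.setCoord k I'))) st

/-- **Replay a fit instruction stream** (nested sub-streams for unrefuted alternative branches of
`place` and for the first branch of `split`; success = every branch ends pruned or fit-verified). -/
def runInstrsF (m : Model) (prm : FitPrm) : Boxes → List Step → List Cut → List InstrF → Bool
  | _, _, _, [] => false
  | bx, st, cuts, InstrF.place terms n :: is =>
    match placeBoxes bx st with
    | none => false
    | some (v, main, alt, rest) =>
      let bxAlt : Boxes := Function.update bx v (some alt)
      let altOK := if certInfeasible bxAlt (rowsOfF m prm bxAlt cuts).toArray terms then true
        else runInstrsF m prm bxAlt rest cuts (is.take n)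
      altOK && runInstrsF m prm (Function.update bx v (some main)) rest cuts (is.drop n)
  | bx, st, cuts, InstrF.split a ub n :: is =>
    if (List.finRange 12).all (fun v => bx.placed v) then
      let c : Cut := ⟨denseCoeff a, ub⟩
      runInstrsF m prm bx st (c :: cuts) (is.take n) && runInstrsF m prm bx st (c.neg :: cuts) (is.drop n)
    else false
  | bx, st, cuts, InstrF.bound v k up cert :: is =>
    match applyBoundF m prm bx st cuts v k up cert with
    | Outcome.pruned => true
    | Outcome.verified => false
    | Outcome.failed => false
    | Outcome.running bx' st' => runInstrsF m prm bx' st' cuts is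
  | bx, _, cuts, InstrF.prune terms :: _ =>
    certInfeasible bx (rowsOfF m prm bx cuts).toArray terms
  | bx, st, cuts, InstrF.fit qw qx qy qz refl certs :: _ =>
    applyFit m prm bx st cuts qw qx qy qz refl certs
termination_by _ _ _ is => is.length

/-- **The fit cell checker.** -/
def runCellF (m : Model) (prm : FitPrm) (c : CellF) : Bool :=
  match initBoxes m c.skel with
  | none => false
  | some none => true
  | some (some bx) => runInstrsF m prm bx m.steps [] c.instrs

/-- **The full fit check of one pattern**: both charts covered and every cell certified. -/
def checkAllF (m : Model) (prm : FitPrm) (cells : List CellF) : Bool :=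
  coversChart (cells.map CellF.skel) true && coversChart (cells.map CellF.skel) false &&
    cells.all (runCellF m prm)

end Rig

end Summit.AtomisticToContinuum.Crystallization.Theorems
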